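import Summits.QuantumFields.YangMills.Theorems.UnitScaleTiltProp7PinnedRegaugeChartLipschitz
import HarnessLib

/-!
# Prop 7 pinned re-gauge chart — the DIAGONAL Lipschitz letters (C¹-Ψ, C¹-Φ♯) for the divergence row of (P-bch)

Route-R E′, path (α′), gap (P-bch-div) of `stmt-QuantumFields-19200` (crux `MinimiserStabilityRegPr`), cell ym3-torus, width seat px15.

WHY THIS FILE.  ✓ `Prop7PinnedRegaugeChartLipschitz.norm_chartRemainder_sub_le` (C¹-Φ) bounds the bondwise differences of the chart
remainder `R₂ = Φ(u₋, u₊, W, E)` by `160(σ + τ)·Σ‖Δa‖` with `σ = sup‖u − 1‖`.  For the ℓ-uniform divergence booking the `u`-slot partner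
must be `ℓ⁻¹`-small (`τ ≍ s‴ℓ⁻¹`, `‖δ‖ ≍ σ₁ℓ⁻¹`), not `σ ≍ σ₀`: the offending piece is the BCH remainder of the corrector's OWN covariant
difference, `Ψ(u, δ) := log(u·e^{−log u + δ}) − δ`, which vanishes identically at `δ = 0` — a cancellation along the diagonal `Y = −X` that the
word-level majorant of ✓ C¹-BCH (`Prop7BCHRemainderLipschitz.norm_bch_sub_bch_le`) cannot see in the variables `(X, Y)`.

WHAT IS PROVED (def-free; `u, u′ ∈ SU(N)`, `E, E′, δ, δ′` matrices, `L²`-operator norm).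
* §1 ★★ `norm_diagBCH_sub_diagBCH_le` (C¹-Ψ, DIAGONAL Lipschitz of the BCH remainder): for `‖u⁽′⁾ − 1‖ ≤ σ ≤ 1∕256`, `‖δ⁽′⁾‖ ≤ ρ ≤ 1∕256`,
  `‖Ψ(u,δ) − Ψ(u′,δ′)‖ ≤ 9ρ·‖log u − log u′‖ + 9σ·‖δ − δ′‖` — the `log u`-difference is partnered with `ρ` (the size of the covariant difference),
  the `δ`-difference with `σ`.  PROOF = the bootstrap of ✓ `Prop7PinnedRegaugeChartBCH.norm_mlog_mul_exp_neg_mlog_add_sub_le` one order up: the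
  IDENTITY `Ψ(u,δ) = −r(−log u, δ + Ψ(u,δ))` (`u*·(u·e^{−log u+δ}) = e^{−log u+δ}`), ✓ C¹-BCH on the right-hand side (partners `‖δ + Ψ‖ ≤ 2ρ` and
  `‖log u‖ ≤ 2σ`), and absorption of `8σ·‖Ψ − Ψ′‖`.
* §2 `regauge_eq_mul_mul_exp` — the re-gauged ratio in the corrector's variables: `u₋·E·W·u₊*·W* = u₋·E·e^{−log u₋ + δ_b}` with
  `δ_b := log u₋ − W(log u₊)W*` (so `W, u₊` enter `R₂` ONLY through the covariant difference `δ_b`), and `chartRemainder_eq` rewriting ✓p653615's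
  `R₂` as `Φ♯(u₋, E, δ_b) := log(u₋·E·e^{−log u₋ + δ_b}) − (log E + δ_b)`.
* §3 ★★★ `norm_chartRemainderDiag_sub_le` (C¹-Φ♯): for `‖u⁽′⁾ − 1‖ ≤ σ`, `‖E⁽′⁾ − 1‖ ≤ τ`, `‖δ⁽′⁾‖ ≤ ρ`, all `≤ 1∕256`:
  `‖Φ♯(u,E,δ) − Φ♯(u′,E′,δ′)‖ ≤ 20(τ + ρ)·‖u − u′‖ + 50(σ + ρ)·‖E − E′‖ + 10(σ + τ)·‖δ − δ′‖`.
  Partners: `Δu ↔ τ + ρ ≍ (s‴ + σ₁)ℓ⁻¹` ✓, `ΔE ↔ σ + ρ`, `Δδ ↔ σ + τ` — the shape the divergence row needs (`Δδ` = second covariant differences of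
  `ψ`, booked by the Weitzenböck identity on `D_Wψ`; `ΔE` = covariant differences of `Y`, booked by Weitzenböck on `D‴`).  Proof: the three-piece
  split `Φ♯ = r(A, L) + (A − log E) + Ψ` (`A = u(log E)u*`, `L = δ + Ψ = log(u·e^{−log u+δ})`), ✓ C¹-BCH on `r(A, L)` (partners `2ρ`, `2τ`),
  ✓ `norm_bilin_sub_bilin_le` on the Leibniz piece, §1 on `Ψ`.
HONEST SCOPE.  Pointwise matrix analysis only; the ℓ² divergence row itself (sum over sites, Weitzenböck, the corrector's equation) is NOT here.
Constants ours; nothing of the cited papers beyond (31) is asserted.  ✓p657531's C¹-Φ remains true; this file supersedes only its `u`-slot constant.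

References: T. Bałaban, CMP 98 (1985) 17–51 [Balaban1985Averaging] ((31) p.22, (8), (11) p.19); CMP 102 (1985) 277–309 [Balaban1985Variational]
((141)–(143) p.299).
-/

set_option autoImplicit false

noncomputable section

open scoped BigOperators Matrix.Norms.L2Operator
open NormedSpace

namespace Summit.QuantumFields.YangMills.Theorems.Prop7PinnedRegaugeChartDiagonal

open Literature.MathematicalPhysics.QuantumFieldTheory.Balaban1983to89
open MatrixLog (mlog exp_mlog norm_mlog_le_two_mul)
open B7BlockAvgLog (mlog_exp)
open MatrixLogLipschitz (norm_mlog_sub_mlog_le)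
open Summit.QuantumFields.YangMills.Theorems.Prop7HolRatioPerStep (coe_star_mul_self coe_mul_star_self norm_coe_eq_one norm_star_coe_eq_one)
open Summit.QuantumFields.YangMills.Theorems.Prop7CovIterLambdaBound (norm_conj_su_le)
open Summit.QuantumFields.YangMills.Theorems.Prop7GaugeTwistLogRatio (exp_conj_coe star_coe_eq_exp_neg_mlog)
open Summit.QuantumFields.YangMills.Theorems.Prop7PinnedRegaugeChartBCH (exp_three_sixteenths_le norm_mlog_mul_exp_neg_mlog_add_sub_le)
open Summit.QuantumFields.YangMills.Theorems.Prop7BCHRemainderLipschitz (norm_bch_sub_bch_le_of_norm_le)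
open Summit.QuantumFields.YangMills.Theorems.Prop7PinnedRegaugeChartLipschitz (norm_conj_sub_conj_le norm_bilin_sub_bilin_le)

variable {n : Type*} [Fintype n] [DecidableEq n] [Nonempty n]

/-! ## §1 C¹-Ψ: diagonal Lipschitz of the BCH remainder -/

section Diagonal

omit [Nonempty n] in
/-- The diagonal data pack for one pair `(u, δ)` with `‖u − 1‖ ≤ σ ≤ 1∕256`, `‖δ‖ ≤ ρ ≤ 1∕256`: `‖log u‖ ≤ 2σ`, `‖ε′‖ ≤ 2ρ` for
`ε′ := log(u·e^{−log u+δ})`, and the bootstrap IDENTITY `r(−log u, ε′) = −Ψ(u,δ)`, i.e.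
`log(e^{−log u}·e^{ε′}) − (−log u) − ε′ = −(ε′ − δ)` (because `e^{−log u}·e^{ε′} = u*·u·e^{−log u+δ} = e^{−log u+δ}`). [cite: Balaban1985Averaging, (31) p.22] -/
theorem diag_pack (u : Matrix.specialUnitaryGroup n ℂ) (δ : Matrix n n ℂ) {σ ρ : ℝ} (hσ : σ ≤ 1 / 256) (hρ : ρ ≤ 1 / 256)
    (hu : ‖(u : Matrix n n ℂ) - 1‖ ≤ σ) (hδ : ‖δ‖ ≤ ρ) :
    ‖mlog (u : Matrix n n ℂ)‖ ≤ 2 * σ ∧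
    ‖mlog ((u : Matrix n n ℂ) * exp (-mlog (u : Matrix n n ℂ) + δ))‖ ≤ 2 * ρ ∧
    mlog (exp (-mlog (u : Matrix n n ℂ)) * exp (mlog ((u : Matrix n n ℂ) * exp (-mlog (u : Matrix n n ℂ) + δ))))
        - -mlog (u : Matrix n n ℂ) - mlog ((u : Matrix n n ℂ) * exp (-mlog (u : Matrix n n ℂ) + δ))
      = -(mlog ((u : Matrix n n ℂ) * exp (-mlog (u : Matrix n n ℂ) + δ)) - δ) := by
  have hσ0 : 0 ≤ σ := (norm_nonneg _).trans hu
  have hρ0 : 0 ≤ ρ := (norm_nonneg _).trans hδ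
  have hu1 : ‖(u : Matrix n n ℂ) - 1‖ < 1 := by linarith
  have hX : ‖mlog (u : Matrix n n ℂ)‖ ≤ 2 * σ := (norm_mlog_le_two_mul (hu.trans (by linarith))).trans (by linarith)
  -- size of `Ψ` by the refined (31)
  have hΨ : ‖mlog ((u : Matrix n n ℂ) * exp (-mlog (u : Matrix n n ℂ) + δ)) - δ‖ ≤ 3 * ‖mlog (u : Matrix n n ℂ)‖ * ‖δ‖ :=
    norm_mlog_mul_exp_neg_mlog_add_sub_le u δ (hu.trans (by linarith)) (hδ.trans (by linarith))
  have hΨ' : ‖mlog ((u : Matrix n n ℂ) * exp (-mlog (u : Matrix n n ℂ) + δ)) - δ‖ ≤ ρ := by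
    have h1 : 3 * ‖mlog (u : Matrix n n ℂ)‖ * ‖δ‖ ≤ 3 * (2 * σ) * ρ :=
      mul_le_mul (by linarith) hδ (norm_nonneg _) (by positivity)
    have h2 : σ * ρ ≤ 1 / 256 * ρ := mul_le_mul_of_nonneg_right hσ hρ0
    linarith
  refine ⟨hX, ?_, ?_⟩
  · have h := norm_le_insert' (mlog ((u : Matrix n n ℂ) * exp (-mlog (u : Matrix n n ℂ) + δ))) δ
    linarith
  · -- the product is in the domain of `log`
    have hpY : ‖exp (-mlog (u : Matrix n n ℂ) + δ) - 1‖ ≤ 2 / 9 := by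
      have h := Literature.Analysis.Calculus.norm_exp_sub_one_le (-mlog (u : Matrix n n ℂ) + δ)
      have hY : ‖-mlog (u : Matrix n n ℂ) + δ‖ ≤ 3 / 16 := by
        have := norm_add_le (-mlog (u : Matrix n n ℂ)) δ
        rw [norm_neg] at this
        linarith
      have h' : Real.exp ‖-mlog (u : Matrix n n ℂ) + δ‖ ≤ Real.exp (3 / 16) := Real.exp_le_exp.mpr hY
      linarith [exp_three_sixteenths_le]
    have hE : ‖(u : Matrix n n ℂ) * exp (-mlog (u : Matrix n n ℂ) + δ) - 1‖ < 1 := by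
      have e : (u : Matrix n n ℂ) * exp (-mlog (u : Matrix n n ℂ) + δ) - 1
          = ((u : Matrix n n ℂ) - 1) + (exp (-mlog (u : Matrix n n ℂ) + δ) - 1) + ((u : Matrix n n ℂ) - 1) * (exp (-mlog (u : Matrix n n ℂ) + δ) - 1) := by
        noncomm_ring
      rw [e]
      have h2 : ‖((u : Matrix n n ℂ) - 1) * (exp (-mlog (u : Matrix n n ℂ) + δ) - 1)‖ ≤ 1 / 64 * (2 / 9) :=
        (norm_mul_le _ _).trans (mul_le_mul (hu.trans (by linarith)) hpY (norm_nonneg _) (by norm_num))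
      have h3 := norm_add₃_le (a := (u : Matrix n n ℂ) - 1) (b := exp (-mlog (u : Matrix n n ℂ) + δ) - 1)
        (c := ((u : Matrix n n ℂ) - 1) * (exp (-mlog (u : Matrix n n ℂ) + δ) - 1))
      linarith
    have hprod : exp (-mlog (u : Matrix n n ℂ)) * exp (mlog ((u : Matrix n n ℂ) * exp (-mlog (u : Matrix n n ℂ) + δ)))
        = exp (-mlog (u : Matrix n n ℂ) + δ) := by
      rw [exp_mlog hE, ← star_coe_eq_exp_neg_mlog u hu1, ← mul_assoc, coe_star_mul_self u, one_mul]
    have hlog2 : ‖-mlog (u : Matrix n n ℂ) + δ‖ < Real.log 2 := by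
      have := Real.log_two_gt_d9
      have := norm_add_le (-mlog (u : Matrix n n ℂ)) δ
      rw [norm_neg] at this
      linarith
    rw [hprod, mlog_exp hlog2]
    abel

/-- ★★ **(C¹-Ψ) DIAGONAL LIPSCHITZ OF THE BCH REMAINDER.**  `Ψ(u, δ) := log(u·e^{−log u + δ}) − δ` (the BCH remainder of the pair
`(log u, −log u + δ)`, which vanishes identically at `δ = 0`).  For `‖u − 1‖, ‖u′ − 1‖ ≤ σ ≤ 1∕256` and `‖δ‖, ‖δ′‖ ≤ ρ ≤ 1∕256`:
`‖Ψ(u,δ) − Ψ(u′,δ′)‖ ≤ 9ρ·‖log u − log u′‖ + 9σ·‖δ − δ′‖`.  The `log u`-difference is partnered with the size `ρ` of the covariant difference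
(NOT with `‖log u‖`): this is the cancellation along the diagonal that the divergence row of (P-bch) needs.  Proof: `Ψ = −r(−log u, δ + Ψ)`
(`diag_pack`), ✓ C¹-BCH (`norm_bch_sub_bch_le_of_norm_le`, partners `2ρ`, `2σ`), absorb `8σ‖Ψ − Ψ′‖`. [cite: Balaban1985Averaging, (31) p.22] -/
theorem norm_diagBCH_sub_diagBCH_le (u u' : Matrix.specialUnitaryGroup n ℂ) (δ δ' : Matrix n n ℂ) {σ ρ : ℝ} (hσ : σ ≤ 1 / 256) (hρ : ρ ≤ 1 / 256)
    (hu : ‖(u : Matrix n n ℂ) - 1‖ ≤ σ) (hu' : ‖(u' : Matrix n n ℂ) - 1‖ ≤ σ) (hδ : ‖δ‖ ≤ ρ) (hδ' : ‖δ'‖ ≤ ρ) :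
    ‖(mlog ((u : Matrix n n ℂ) * exp (-mlog (u : Matrix n n ℂ) + δ)) - δ)
        - (mlog ((u' : Matrix n n ℂ) * exp (-mlog (u' : Matrix n n ℂ) + δ')) - δ')‖
      ≤ 9 * ρ * ‖mlog (u : Matrix n n ℂ) - mlog (u' : Matrix n n ℂ)‖ + 9 * σ * ‖δ - δ'‖ := by
  have hσ0 : 0 ≤ σ := (norm_nonneg _).trans hu
  have hρ0 : 0 ≤ ρ := (norm_nonneg _).trans hδ
  obtain ⟨hX, hε, hid⟩ := diag_pack u δ hσ hρ hu hδ
  obtain ⟨hX', hε', hid'⟩ := diag_pack u' δ' hσ hρ hu' hδ'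
  -- C¹-BCH for the pairs `(−log u, ε′)`, `(−log u′, ε′₁)`
  have hnX : ‖-mlog (u : Matrix n n ℂ)‖ ≤ 2 * σ := by rw [norm_neg]; exact hX
  have hnX' : ‖-mlog (u' : Matrix n n ℂ)‖ ≤ 2 * σ := by rw [norm_neg]; exact hX'
  have t := norm_bch_sub_bch_le_of_norm_le (X := -mlog (u : Matrix n n ℂ)) (X' := -mlog (u' : Matrix n n ℂ))
    (Y := mlog ((u : Matrix n n ℂ) * exp (-mlog (u : Matrix n n ℂ) + δ))) (Y' := mlog ((u' : Matrix n n ℂ) * exp (-mlog (u' : Matrix n n ℂ) + δ')))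
    hnX hnX' hε hε' (by linarith) (by linarith)
  rw [hid, hid'] at t
  have e1 : ‖-(mlog ((u : Matrix n n ℂ) * exp (-mlog (u : Matrix n n ℂ) + δ)) - δ) - -(mlog ((u' : Matrix n n ℂ) * exp (-mlog (u' : Matrix n n ℂ) + δ')) - δ')‖
      = ‖(mlog ((u : Matrix n n ℂ) * exp (-mlog (u : Matrix n n ℂ) + δ)) - δ) - (mlog ((u' : Matrix n n ℂ) * exp (-mlog (u' : Matrix n n ℂ) + δ')) - δ')‖ := by
    rw [← norm_neg]; congr 1; abel
  have e2 : ‖-mlog (u : Matrix n n ℂ) - -mlog (u' : Matrix n n ℂ)‖ = ‖mlog (u : Matrix n n ℂ) - mlog (u' : Matrix n n ℂ)‖ := by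
    rw [← norm_neg]; congr 1; abel
  rw [e1, e2] at t
  -- `‖ε′ − ε′₁‖ ≤ ‖δ − δ′‖ + ‖Ψ − Ψ′‖`
  have hεε : ‖mlog ((u : Matrix n n ℂ) * exp (-mlog (u : Matrix n n ℂ) + δ)) - mlog ((u' : Matrix n n ℂ) * exp (-mlog (u' : Matrix n n ℂ) + δ'))‖
      ≤ ‖δ - δ'‖ + ‖(mlog ((u : Matrix n n ℂ) * exp (-mlog (u : Matrix n n ℂ) + δ)) - δ) - (mlog ((u' : Matrix n n ℂ) * exp (-mlog (u' : Matrix n n ℂ) + δ')) - δ')‖ := by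
    have e : mlog ((u : Matrix n n ℂ) * exp (-mlog (u : Matrix n n ℂ) + δ)) - mlog ((u' : Matrix n n ℂ) * exp (-mlog (u' : Matrix n n ℂ) + δ'))
        = (δ - δ') + ((mlog ((u : Matrix n n ℂ) * exp (-mlog (u : Matrix n n ℂ) + δ)) - δ) - (mlog ((u' : Matrix n n ℂ) * exp (-mlog (u' : Matrix n n ℂ) + δ')) - δ')) := by
      abel
    rw [e]; exact norm_add_le _ _
  -- absorb
  have ht0 : 0 ≤ ‖(mlog ((u : Matrix n n ℂ) * exp (-mlog (u : Matrix n n ℂ) + δ)) - δ) - (mlog ((u' : Matrix n n ℂ) * exp (-mlog (u' : Matrix n n ℂ) + δ')) - δ')‖ :=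
    norm_nonneg _
  have hd0 : 0 ≤ ‖mlog (u : Matrix n n ℂ) - mlog (u' : Matrix n n ℂ)‖ := norm_nonneg _
  have hd1 : 0 ≤ ‖δ - δ'‖ := norm_nonneg _
  have h8 : 4 * (2 * σ) * ‖mlog ((u : Matrix n n ℂ) * exp (-mlog (u : Matrix n n ℂ) + δ)) - mlog ((u' : Matrix n n ℂ) * exp (-mlog (u' : Matrix n n ℂ) + δ'))‖
      ≤ 4 * (2 * σ) * (‖δ - δ'‖ + ‖(mlog ((u : Matrix n n ℂ) * exp (-mlog (u : Matrix n n ℂ) + δ)) - δ) - (mlog ((u' : Matrix n n ℂ) * exp (-mlog (u' : Matrix n n ℂ) + δ')) - δ')‖) :=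
    mul_le_mul_of_nonneg_left hεε (by positivity)
  have p1 := mul_nonneg hσ0 ht0
  have p2 := mul_nonneg hσ0 hd1
  have p3 := mul_nonneg hρ0 hd0
  have hst : σ * ‖(mlog ((u : Matrix n n ℂ) * exp (-mlog (u : Matrix n n ℂ) + δ)) - δ) - (mlog ((u' : Matrix n n ℂ) * exp (-mlog (u' : Matrix n n ℂ) + δ')) - δ')‖
      ≤ 1 / 256 * ‖(mlog ((u : Matrix n n ℂ) * exp (-mlog (u : Matrix n n ℂ) + δ)) - δ) - (mlog ((u' : Matrix n n ℂ) * exp (-mlog (u' : Matrix n n ℂ) + δ')) - δ')‖ :=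
    mul_le_mul_of_nonneg_right hσ ht0
  linarith

/-- (C¹-Ψ) with the group elements: `‖Ψ(u,δ) − Ψ(u′,δ′)‖ ≤ 18ρ·‖u − u′‖ + 9σ·‖δ − δ′‖` (✓ `MatrixLogLipschitz.norm_mlog_sub_mlog_le`,
radius `1∕2`). [cite: Balaban1985Averaging, (31) p.22] -/
theorem norm_diagBCH_sub_diagBCH_le' (u u' : Matrix.specialUnitaryGroup n ℂ) (δ δ' : Matrix n n ℂ) {σ ρ : ℝ} (hσ : σ ≤ 1 / 256) (hρ : ρ ≤ 1 / 256)
    (hu : ‖(u : Matrix n n ℂ) - 1‖ ≤ σ) (hu' : ‖(u' : Matrix n n ℂ) - 1‖ ≤ σ) (hδ : ‖δ‖ ≤ ρ) (hδ' : ‖δ'‖ ≤ ρ) :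
    ‖(mlog ((u : Matrix n n ℂ) * exp (-mlog (u : Matrix n n ℂ) + δ)) - δ)
        - (mlog ((u' : Matrix n n ℂ) * exp (-mlog (u' : Matrix n n ℂ) + δ')) - δ')‖
      ≤ 18 * ρ * ‖(u : Matrix n n ℂ) - (u' : Matrix n n ℂ)‖ + 9 * σ * ‖δ - δ'‖ := by
  have hρ0 : 0 ≤ ρ := (norm_nonneg _).trans hδ
  have h := norm_diagBCH_sub_diagBCH_le u u' δ δ' hσ hρ hu hu' hδ hδ'
  have hl := norm_mlog_sub_mlog_le (r := 1 / 2) (by norm_num) (hu.trans (by linarith)) (hu'.trans (by linarith))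
  have e : ‖(u : Matrix n n ℂ) - (u' : Matrix n n ℂ)‖ / (1 - 1 / 2) = 2 * ‖(u : Matrix n n ℂ) - (u' : Matrix n n ℂ)‖ := by ring
  rw [e] at hl
  have h1 : 9 * ρ * ‖mlog (u : Matrix n n ℂ) - mlog (u' : Matrix n n ℂ)‖ ≤ 9 * ρ * (2 * ‖(u : Matrix n n ℂ) - (u' : Matrix n n ℂ)‖) :=
    mul_le_mul_of_nonneg_left hl (by positivity)
  linarith

end Diagonal

/-! ## §2 The re-gauged ratio in the corrector's variables -/

section Variables

omit [Nonempty n] in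
/-- **`W` and `u₊` enter only through the covariant difference.**  For `‖u₊ − 1‖ < 1`:
`u₋·E·W·u₊*·W* = u₋·E·e^{−log u₋ + δ_b}` with `δ_b := log u₋ − W(log u₊)W*` (because `e^{−W(log u₊)W*} = W·e^{−log u₊}·W* = W·u₊*·W*`).
[cite: Balaban1985Variational, (141)-(143) p.299] -/
theorem regauge_eq_mul_mul_exp (um up W : Matrix.specialUnitaryGroup n ℂ) (E : Matrix n n ℂ) (hp : ‖(up : Matrix n n ℂ) - 1‖ < 1) :
    (um : Matrix n n ℂ) * E * (W : Matrix n n ℂ) * star (up : Matrix n n ℂ) * star (W : Matrix n n ℂ)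
      = (um : Matrix n n ℂ) * E * exp (-mlog (um : Matrix n n ℂ) + (mlog (um : Matrix n n ℂ) - (W : Matrix n n ℂ) * mlog (up : Matrix n n ℂ) * star (W : Matrix n n ℂ))) := by
  have e1 : -mlog (um : Matrix n n ℂ) + (mlog (um : Matrix n n ℂ) - (W : Matrix n n ℂ) * mlog (up : Matrix n n ℂ) * star (W : Matrix n n ℂ))
      = (W : Matrix n n ℂ) * (-mlog (up : Matrix n n ℂ)) * star (W : Matrix n n ℂ) := by
    rw [mul_neg, neg_mul]; abel
  rw [e1, exp_conj_coe W, ← star_coe_eq_exp_neg_mlog up hp]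
  simp only [mul_assoc]

omit [Nonempty n] in
/-- **The chart remainder in the corrector's variables.**  For `‖u₊ − 1‖ < 1`, ✓p653615's
`R₂ = log(u₋·E·W·u₊*·W*) − (log E + (log u₋ − W(log u₊)W*))` equals `Φ♯(u₋, E, δ_b) := log(u₋·E·e^{−log u₋ + δ_b}) − (log E + δ_b)`,
`δ_b = log u₋ − W(log u₊)W*`. [cite: Balaban1985Variational, (141)-(143) p.299] -/
theorem chartRemainder_eq (um up W : Matrix.specialUnitaryGroup n ℂ) (E : Matrix n n ℂ) (hp : ‖(up : Matrix n n ℂ) - 1‖ < 1) :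
    mlog ((um : Matrix n n ℂ) * E * (W : Matrix n n ℂ) * star (up : Matrix n n ℂ) * star (W : Matrix n n ℂ))
        - (mlog E + (mlog (um : Matrix n n ℂ) - (W : Matrix n n ℂ) * mlog (up : Matrix n n ℂ) * star (W : Matrix n n ℂ)))
      = mlog ((um : Matrix n n ℂ) * E * exp (-mlog (um : Matrix n n ℂ) + (mlog (um : Matrix n n ℂ) - (W : Matrix n n ℂ) * mlog (up : Matrix n n ℂ) * star (W : Matrix n n ℂ))))
        - (mlog E + (mlog (um : Matrix n n ℂ) - (W : Matrix n n ℂ) * mlog (up : Matrix n n ℂ) * star (W : Matrix n n ℂ))) := by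
  rw [regauge_eq_mul_mul_exp um up W E hp]

/-- Size of the covariant-difference letter: `‖log u₋ − W(log u₊)W*‖ ≤ ‖log u₋‖ + ‖log u₊‖ ≤ 2‖u₋ − 1‖ + 2‖u₊ − 1‖` (for `‖u± − 1‖ ≤ 1∕2`).
[cite: Balaban1985Averaging, (8) p.19] -/
theorem norm_covDiffLetter_le (um up W : Matrix.specialUnitaryGroup n ℂ) (hm : ‖(um : Matrix n n ℂ) - 1‖ ≤ 1 / 2) (hp : ‖(up : Matrix n n ℂ) - 1‖ ≤ 1 / 2) :
    ‖mlog (um : Matrix n n ℂ) - (W : Matrix n n ℂ) * mlog (up : Matrix n n ℂ) * star (W : Matrix n n ℂ)‖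
      ≤ 2 * ‖(um : Matrix n n ℂ) - 1‖ + 2 * ‖(up : Matrix n n ℂ) - 1‖ := by
  have h1 := norm_mlog_le_two_mul hm
  have h2 := (norm_conj_su_le W (mlog (up : Matrix n n ℂ))).trans (norm_mlog_le_two_mul hp)
  exact (norm_sub_le _ _).trans (add_le_add h1 h2)

end Variables

/-! ## §3 C¹-Φ♯: the chart remainder is Lipschitz with the right partners -/

section Sharp

omit [Nonempty n] in
/-- The three-piece split of `Φ♯` (as in ✓p653615∕✓p657531, in the corrector's variables): for `‖u − 1‖ ≤ σ ≤ 1∕256`, `‖E − 1‖ < 1`,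
`‖δ‖ ≤ ρ ≤ 1∕256`, with `A := u(log E)u*`, `L := log(u·e^{−log u+δ})`:
`Φ♯(u,E,δ) = r(A, L) + ((u − 1)(log E)u* + (log E)(u* − 1)) + (L − δ)`, `r(A,L) := log(e^A e^L) − A − L`
(because `e^A·e^L = uEu*·u·e^{−log u+δ} = u·E·e^{−log u+δ}`). [cite: Balaban1985Variational, (141)-(143) p.299] -/
theorem chartRemainderDiag_split (u : Matrix.specialUnitaryGroup n ℂ) (E δ : Matrix n n ℂ) {σ ρ : ℝ} (hσ : σ ≤ 1 / 256) (hρ : ρ ≤ 1 / 256)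
    (hu : ‖(u : Matrix n n ℂ) - 1‖ ≤ σ) (hE : ‖E - 1‖ < 1) (hδ : ‖δ‖ ≤ ρ) :
    mlog ((u : Matrix n n ℂ) * E * exp (-mlog (u : Matrix n n ℂ) + δ)) - (mlog E + δ)
      = (mlog (exp ((u : Matrix n n ℂ) * mlog E * star (u : Matrix n n ℂ)) * exp (mlog ((u : Matrix n n ℂ) * exp (-mlog (u : Matrix n n ℂ) + δ))))
            - (u : Matrix n n ℂ) * mlog E * star (u : Matrix n n ℂ) - mlog ((u : Matrix n n ℂ) * exp (-mlog (u : Matrix n n ℂ) + δ)))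
        + (((u : Matrix n n ℂ) - 1) * mlog E * star (u : Matrix n n ℂ) + mlog E * (star (u : Matrix n n ℂ) - 1))
        + (mlog ((u : Matrix n n ℂ) * exp (-mlog (u : Matrix n n ℂ) + δ)) - δ) := by
  have hσ0 : 0 ≤ σ := (norm_nonneg _).trans hu
  have hρ0 : 0 ≤ ρ := (norm_nonneg _).trans hδ
  -- `u·e^{−log u+δ}` is in the domain of `log` (as in `diag_pack`)
  have hpY : ‖exp (-mlog (u : Matrix n n ℂ) + δ) - 1‖ ≤ 2 / 9 := by
    have h := Literature.Analysis.Calculus.norm_exp_sub_one_le (-mlog (u : Matrix n n ℂ) + δ)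
    have hX : ‖mlog (u : Matrix n n ℂ)‖ ≤ 2 * σ := (norm_mlog_le_two_mul (hu.trans (by linarith))).trans (by linarith)
    have hY : ‖-mlog (u : Matrix n n ℂ) + δ‖ ≤ 3 / 16 := by
      have := norm_add_le (-mlog (u : Matrix n n ℂ)) δ
      rw [norm_neg] at this
      linarith
    have h' : Real.exp ‖-mlog (u : Matrix n n ℂ) + δ‖ ≤ Real.exp (3 / 16) := Real.exp_le_exp.mpr hY
    linarith [exp_three_sixteenths_le]
  have hG : ‖(u : Matrix n n ℂ) * exp (-mlog (u : Matrix n n ℂ) + δ) - 1‖ < 1 := by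
    have e : (u : Matrix n n ℂ) * exp (-mlog (u : Matrix n n ℂ) + δ) - 1
        = ((u : Matrix n n ℂ) - 1) + (exp (-mlog (u : Matrix n n ℂ) + δ) - 1) + ((u : Matrix n n ℂ) - 1) * (exp (-mlog (u : Matrix n n ℂ) + δ) - 1) := by
      noncomm_ring
    rw [e]
    have h2 : ‖((u : Matrix n n ℂ) - 1) * (exp (-mlog (u : Matrix n n ℂ) + δ) - 1)‖ ≤ 1 / 64 * (2 / 9) :=
      (norm_mul_le _ _).trans (mul_le_mul (hu.trans (by linarith)) hpY (norm_nonneg _) (by norm_num))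
    have h3 := norm_add₃_le (a := (u : Matrix n n ℂ) - 1) (b := exp (-mlog (u : Matrix n n ℂ) + δ) - 1)
      (c := ((u : Matrix n n ℂ) - 1) * (exp (-mlog (u : Matrix n n ℂ) + δ) - 1))
    linarith
  have hprod : exp ((u : Matrix n n ℂ) * mlog E * star (u : Matrix n n ℂ)) * exp (mlog ((u : Matrix n n ℂ) * exp (-mlog (u : Matrix n n ℂ) + δ)))
      = (u : Matrix n n ℂ) * E * exp (-mlog (u : Matrix n n ℂ) + δ) := by
    rw [exp_conj_coe u, exp_mlog hE, exp_mlog hG]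
    calc (u : Matrix n n ℂ) * E * star (u : Matrix n n ℂ) * ((u : Matrix n n ℂ) * exp (-mlog (u : Matrix n n ℂ) + δ))
        = (u : Matrix n n ℂ) * E * (star (u : Matrix n n ℂ) * (u : Matrix n n ℂ)) * exp (-mlog (u : Matrix n n ℂ) + δ) := by
          simp only [mul_assoc]
      _ = (u : Matrix n n ℂ) * E * exp (-mlog (u : Matrix n n ℂ) + δ) := by rw [coe_star_mul_self u, mul_one]
  rw [hprod]
  have e2 : ((u : Matrix n n ℂ) - 1) * mlog E * star (u : Matrix n n ℂ) + mlog E * (star (u : Matrix n n ℂ) - 1)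
      = (u : Matrix n n ℂ) * mlog E * star (u : Matrix n n ℂ) - mlog E := by noncomm_ring
  rw [e2]
  abel

/-- ★★★ **(C¹-Φ♯) THE CHART REMAINDER IS LIPSCHITZ WITH THE RIGHT PARTNERS.**  `Φ♯(u, E, δ) := log(u·E·e^{−log u + δ}) − (log E + δ)`
(= ✓p653615's `R₂` by `chartRemainder_eq`, `δ = δ_b` the covariant difference of the gauge letter).  For `‖u⁽′⁾ − 1‖ ≤ σ`, `‖E⁽′⁾ − 1‖ ≤ τ`,
`‖δ⁽′⁾‖ ≤ ρ`, `σ, τ, ρ ≤ 1∕256`: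
`‖Φ♯(u,E,δ) − Φ♯(u′,E′,δ′)‖ ≤ 20(τ + ρ)·‖u − u′‖ + 50(σ + ρ)·‖E − E′‖ + 10(σ + τ)·‖δ − δ′‖`.
The `u`-slot is partnered with `τ + ρ` (chart size + covariant-difference size, both `ℓ⁻¹`-small downstream), the `E`- and `δ`-slots with `σ`.
Proof: `chartRemainderDiag_split`; ✓ C¹-BCH on `r(A, L)` (partners `‖L‖ ≤ 2ρ`, `‖A‖ ≤ 2τ`); ✓ `norm_bilin_sub_bilin_le`; C¹-Ψ (§1);
`log`-Lipschitz (radius `1∕2`). [cite: Balaban1985Averaging, (31) p.22] [cite: Balaban1985Variational, (141)-(143) p.299] -/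
theorem norm_chartRemainderDiag_sub_le (u u' : Matrix.specialUnitaryGroup n ℂ) (E E' δ δ' : Matrix n n ℂ) {σ τ ρ : ℝ}
    (hσ : σ ≤ 1 / 256) (hτ : τ ≤ 1 / 256) (hρ : ρ ≤ 1 / 256)
    (hu : ‖(u : Matrix n n ℂ) - 1‖ ≤ σ) (hu' : ‖(u' : Matrix n n ℂ) - 1‖ ≤ σ) (hE : ‖E - 1‖ ≤ τ) (hE' : ‖E' - 1‖ ≤ τ)
    (hδ : ‖δ‖ ≤ ρ) (hδ' : ‖δ'‖ ≤ ρ) :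
    ‖(mlog ((u : Matrix n n ℂ) * E * exp (-mlog (u : Matrix n n ℂ) + δ)) - (mlog E + δ))
        - (mlog ((u' : Matrix n n ℂ) * E' * exp (-mlog (u' : Matrix n n ℂ) + δ')) - (mlog E' + δ'))‖
      ≤ 20 * (τ + ρ) * ‖(u : Matrix n n ℂ) - (u' : Matrix n n ℂ)‖ + 50 * (σ + ρ) * ‖E - E'‖ + 10 * (σ + τ) * ‖δ - δ'‖ := by
  have hσ0 : 0 ≤ σ := (norm_nonneg _).trans hu
  have hτ0 : 0 ≤ τ := (norm_nonneg _).trans hE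
  have hρ0 : 0 ≤ ρ := (norm_nonneg _).trans hδ
  have hE1 : ‖E - 1‖ < 1 := by linarith
  have hE1' : ‖E' - 1‖ < 1 := by linarith
  have hlogE : ‖mlog E‖ ≤ 2 * τ := (norm_mlog_le_two_mul (hE.trans (by linarith))).trans (by linarith)
  have hlogE' : ‖mlog E'‖ ≤ 2 * τ := (norm_mlog_le_two_mul (hE'.trans (by linarith))).trans (by linarith)
  -- Lipschitz of `log` (radius 1∕2)
  have hlip : ∀ {A B : Matrix n n ℂ}, ‖A - 1‖ ≤ 1 / 2 → ‖B - 1‖ ≤ 1 / 2 → ‖mlog A - mlog B‖ ≤ 2 * ‖A - B‖ := by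
    intro A B hA hB
    have h := norm_mlog_sub_mlog_le (r := 1 / 2) (by norm_num) hA hB
    have e : ‖A - B‖ / (1 - 1 / 2) = 2 * ‖A - B‖ := by ring
    rwa [e] at h
  obtain ⟨-, hL, -⟩ := diag_pack u δ hσ hρ hu hδ
  obtain ⟨-, hL', -⟩ := diag_pack u' δ' hσ hρ hu' hδ'
  rw [chartRemainderDiag_split u E δ hσ hρ hu hE1 hδ, chartRemainderDiag_split u' E' δ' hσ hρ hu' hE1' hδ']
  -- term 1: C¹-BCH on `r(A, L)`
  have hA : ‖(u : Matrix n n ℂ) * mlog E * star (u : Matrix n n ℂ)‖ ≤ 2 * τ := (norm_conj_su_le u _).trans hlogE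
  have hA' : ‖(u' : Matrix n n ℂ) * mlog E' * star (u' : Matrix n n ℂ)‖ ≤ 2 * τ := (norm_conj_su_le u' _).trans hlogE'
  have t1 := norm_bch_sub_bch_le_of_norm_le (X := (u : Matrix n n ℂ) * mlog E * star (u : Matrix n n ℂ))
    (Y := mlog ((u : Matrix n n ℂ) * exp (-mlog (u : Matrix n n ℂ) + δ)))
    (X' := (u' : Matrix n n ℂ) * mlog E' * star (u' : Matrix n n ℂ))
    (Y' := mlog ((u' : Matrix n n ℂ) * exp (-mlog (u' : Matrix n n ℂ) + δ')))
    hA hA' hL hL' (by linarith) (by linarith)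
  have hl2 : ‖mlog E - mlog E'‖ ≤ 2 * ‖E - E'‖ := hlip (hE.trans (by linarith)) (hE'.trans (by linarith))
  have dA : ‖(u : Matrix n n ℂ) * mlog E * star (u : Matrix n n ℂ) - (u' : Matrix n n ℂ) * mlog E' * star (u' : Matrix n n ℂ)‖
      ≤ 2 * (2 * τ) * ‖(u : Matrix n n ℂ) - (u' : Matrix n n ℂ)‖ + 3 * (2 * ‖E - E'‖) := by
    have h := norm_conj_sub_conj_le u u' (mlog E) (mlog E')
    have h0 : 0 ≤ ‖(u : Matrix n n ℂ) - (u' : Matrix n n ℂ)‖ := norm_nonneg _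
    have h1 : 2 * ‖mlog E‖ * ‖(u : Matrix n n ℂ) - (u' : Matrix n n ℂ)‖ ≤ 2 * (2 * τ) * ‖(u : Matrix n n ℂ) - (u' : Matrix n n ℂ)‖ :=
      mul_le_mul_of_nonneg_right (by linarith) h0
    linarith
  -- term 3 (and the `L`-difference of term 1): C¹-Ψ
  have t3 := norm_diagBCH_sub_diagBCH_le' u u' δ δ' hσ hρ hu hu' hδ hδ'
  have dL : ‖mlog ((u : Matrix n n ℂ) * exp (-mlog (u : Matrix n n ℂ) + δ)) - mlog ((u' : Matrix n n ℂ) * exp (-mlog (u' : Matrix n n ℂ) + δ'))‖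
      ≤ ‖δ - δ'‖ + (18 * ρ * ‖(u : Matrix n n ℂ) - (u' : Matrix n n ℂ)‖ + 9 * σ * ‖δ - δ'‖) := by
    have e : mlog ((u : Matrix n n ℂ) * exp (-mlog (u : Matrix n n ℂ) + δ)) - mlog ((u' : Matrix n n ℂ) * exp (-mlog (u' : Matrix n n ℂ) + δ'))
        = (δ - δ') + ((mlog ((u : Matrix n n ℂ) * exp (-mlog (u : Matrix n n ℂ) + δ)) - δ) - (mlog ((u' : Matrix n n ℂ) * exp (-mlog (u' : Matrix n n ℂ) + δ')) - δ')) := by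
      abel
    rw [e]; exact (norm_add_le _ _).trans (add_le_add le_rfl t3)
  -- term 2: Leibniz
  have t2 := norm_bilin_sub_bilin_le u u' (mlog E) (mlog E')
  -- assemble
  have hd0 : 0 ≤ ‖(u : Matrix n n ℂ) - (u' : Matrix n n ℂ)‖ := norm_nonneg _
  have hd2 : 0 ≤ ‖E - E'‖ := norm_nonneg _
  have hd3 : 0 ≤ ‖δ - δ'‖ := norm_nonneg _
  have T1 := t1.trans (add_le_add (mul_le_mul_of_nonneg_left dA (by positivity)) (mul_le_mul_of_nonneg_left dL (by positivity)))
  have T2' : 3 * (‖mlog E‖ + ‖mlog E'‖) * ‖(u : Matrix n n ℂ) - (u' : Matrix n n ℂ)‖ + 2 * ‖(u' : Matrix n n ℂ) - 1‖ * ‖mlog E - mlog E'‖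
      ≤ 3 * (2 * τ + 2 * τ) * ‖(u : Matrix n n ℂ) - (u' : Matrix n n ℂ)‖ + 2 * σ * (2 * ‖E - E'‖) := by
    have a1 : 3 * (‖mlog E‖ + ‖mlog E'‖) * ‖(u : Matrix n n ℂ) - (u' : Matrix n n ℂ)‖ ≤ 3 * (2 * τ + 2 * τ) * ‖(u : Matrix n n ℂ) - (u' : Matrix n n ℂ)‖ :=
      mul_le_mul_of_nonneg_right (by linarith) hd0
    have a2 : 2 * ‖(u' : Matrix n n ℂ) - 1‖ * ‖mlog E - mlog E'‖ ≤ 2 * σ * (2 * ‖E - E'‖) :=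
      mul_le_mul (by linarith) hl2 (norm_nonneg _) (by linarith)
    linarith
  have T2 := t2.trans T2'
  rw [show ∀ (x y z x' y' z' : Matrix n n ℂ), (x + y + z) - (x' + y' + z') = (x - x') + (y - y') + (z - z') from fun _ _ _ _ _ _ => by abel]
  refine norm_add₃_le.trans ((add_le_add (add_le_add T1 T2) t3).trans ?_)
  -- linear arithmetic with product atoms
  have h1 : ρ * τ * ‖(u : Matrix n n ℂ) - (u' : Matrix n n ℂ)‖ ≤ 1 / 256 * τ * ‖(u : Matrix n n ℂ) - (u' : Matrix n n ℂ)‖ :=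
    mul_le_mul_of_nonneg_right (mul_le_mul_of_nonneg_right hρ hτ0) hd0
  have h2 : σ * τ * ‖δ - δ'‖ ≤ 1 / 256 * τ * ‖δ - δ'‖ :=
    mul_le_mul_of_nonneg_right (mul_le_mul_of_nonneg_right hσ hτ0) hd3
  have p0 := mul_nonneg hσ0 hd0
  have p2 := mul_nonneg hσ0 hd2
  have p3 := mul_nonneg hσ0 hd3
  have q0 := mul_nonneg hτ0 hd0
  have q2 := mul_nonneg hτ0 hd2
  have q3 := mul_nonneg hτ0 hd3
  have r0 := mul_nonneg hρ0 hd0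
  have r2 := mul_nonneg hρ0 hd2
  have r3 := mul_nonneg hρ0 hd3
  have s0 := mul_nonneg (mul_nonneg hρ0 hτ0) hd0
  have s3 := mul_nonneg (mul_nonneg hσ0 hτ0) hd3
  linarith

end Sharp

end Summit.QuantumFields.YangMills.Theorems.Prop7PinnedRegaugeChartDiagonal

end
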